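import Mathlib
import HarnessLib
import Summits.HubbardSuperconductivity.HubbardSuperconductivity.Theorems.KLProgrammePerturbedFermiCurveWindowJetsDefs

/-!
# Route `KLProgramme` — the frame's Fermi-radius tower against the FREE radius at the SHIFTED level
# `ν′(θ) = ε₀(k_F^K(θ)) = ν + K(k_F^K(θ))`: order 0 EXACT, orders 1–4 LINEAR in the frame's derivative sizes `A₁ … A₄` (no `A₀`)

Cell `gate-hubbard-kl`, seat hubbard-kl-k3c3-p3 (g8; row «implicit-function / monotonicity route for μ(n)»); helper for the engine-flow
child `KLRegimeEngineV17F2` (stmt-HubbardSuperconductivity-20437), stub (C) `stub_twoLeg_curvature`, (C1) certificate lane of k3c3-p1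
(`…CountertermJacksonRemainderCertDefs`: the named numerical hypothesis `CutoffDefectCert d cmax δ T` quantifies over `C⁴` radii `r` whose
4-jet at `θ` is within `δ` of the FREE radius' jet `u_ν^{(j)}(θ)`; the cutoff is read at the shifted level `ν − c`, `|c| ≤ cmax`).
KL STATUS l.3453 (3): «the certificate's jet box is RELATIVE TO THE LEVEL-SHIFTED FREE CURVE … what the closer needs is a SHARP tower
`|∂ʲu_K(θ) − ∂ʲu_{ν′}(θ)|` against the free radius at the SHIFTED level `ν′ := ε(k_F^K(θ)) = μ + K(k_F^K θ)` (order 0 is then EXACT),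
driven by `A₁ … A₄` only, not by `A₀`».

This module is that tower.  Frame `K : TrigPolyC4v` with PER-ORDER sizes `‖Dʲ frameShift K‖ ≤ A_j` on `Momentum` (`j = 0 … 4`),
`2A₁ < Dt_min`, level `ν` with `[ν − A₀, ν + A₀] ⊂ [a, b]`, `B : BandBounds a b`; frame radius `u_K = perturbedFermiRadius δ_K ν`
(`δ_K = −K.eval`, the `klFermiPoint` selection); at the angle `θ` the SHIFTED LEVEL is `ν′(θ) = ν − δ_K(u_K(θ)·dir θ) = ν + K(u_K(θ)·dir θ)`.
* §1 `ν′(θ) ∈ [ν − A₀, ν + A₀] ⊂ [a, b]` and **`u_K(θ) = u_{ν′(θ)}(θ)` EXACTLY** (the tree's `perturbedFermiRadius_eq_bandFermiRadius`).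
* §2 At a common point (`W₀ = 0`) the lineage's POINTWISE two-curve lemmas `abs_deriv_{·,two,three,four}_sub_le_of_polar_levels`
  (…TwoFrameTower/3/4) compare `u_K` with `u_{ν′}` for ANY level `ν′ ∈ [a, b]` with `u_K(θ) = u_{ν′}(θ)`: the level-function differences
  at the common point are `Δ_j = ‖Dʲδ_K(p₀)‖ ≤ 2ʲA_j` (`j ≥ 1`), the free band's sizes are `E_j = 4`, the radius bound `U₀` is an INPUT
  (the window table's `umax`, not `π√2`).  Orders 1–4, each LINEAR in `(A₁, …, A_k)` and the lower widths:
  `W₁ = (U₀ + R₁)·2A₁/ρ₀`, `ρ₀ = Dt_min − 2A₁`; `W₂, W₃, W₄` in closed form (§2 docstrings).  No `A₀` anywhere.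
* (companion `…PerturbedFermiCurveShiftedLevelJets`: the packaged tower on a level window, the `FreeBandPolarJets`-fed form, and the
  consumer shape `∃ ν′ …, ∀ j ≤ 4, |iteratedDeriv j u_K θ − iteratedDeriv j (bandFermiRadius ν′) θ| ≤ δ j` of `CutoffDefectCert … δ …`.)
Everything is PROVED; no definitions; nothing about the Hubbard model beyond the free band `ε₀`.  References: BGM 2006 §2.4 Lemma 2.1
(2.40) [cite: BenfattoGiulianiMastropietro2006]; FST IV (CPAM 53 (2000) 1350) Thm 2; memo HOME/hubbard-kl-k3c3-p3/WINDOW-JETS.md.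
-/

noncomputable section

namespace Summit.HubbardSuperconductivity.HubbardSuperconductivity.Theorems.PerturbedFermiCurve

set_option linter.dupNamespace false -- summit = problem name (single-conjunct summit), D-0017
set_option maxSynthPendingDepth 4 -- nested operator-norm instances (up to fourth Fréchet derivatives)

open Real Set
open Literature.MathematicalPhysics.QuantumLattice Literature.MathematicalPhysics.QuantumLattice.BandSectorCounting
open Summit.HubbardSuperconductivity.HubbardSuperconductivity.Theorems.DispersionFlow
open Summit.HubbardSuperconductivity.HubbardSuperconductivity.Theorems.KLRegimeSplit

section Frame

variable {a b : ℝ} (B : BandBounds a b) {K : TrigPolyC4v} {A₀ A₁ A₂ A₃ A₄ : ℝ}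
  (hA₀ : ∀ p : Momentum, ‖iteratedFDeriv ℝ 0 (frameShift K) p‖ ≤ A₀)
  (hA₁ : ∀ p : Momentum, ‖iteratedFDeriv ℝ 1 (frameShift K) p‖ ≤ A₁)
  (hA₂ : ∀ p : Momentum, ‖iteratedFDeriv ℝ 2 (frameShift K) p‖ ≤ A₂)
  (hA₃ : ∀ p : Momentum, ‖iteratedFDeriv ℝ 3 (frameShift K) p‖ ≤ A₃)
  (hA₄ : ∀ p : Momentum, ‖iteratedFDeriv ℝ 4 (frameShift K) p‖ ≤ A₄)
  (hA₁Dt : 2 * A₁ < B.Dtmin) {ν : ℝ} (hlo : a ≤ ν - A₀) (hhi : ν + A₀ ≤ b)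

/-! ## §1 The shifted level `ν′(θ) = ν − δ_K(u_K(θ)·dir θ) = ν + K(u_K(θ)·dir θ)`: margins, and order 0 EXACT -/

omit B in
/-- `ν − δ_K(p) = ν + K(p)`. -/
theorem frameShiftedLevel_eq (p : Fin 2 → ℝ) : ν - (fun q : Fin 2 → ℝ => -K.eval q) p = ν + K.eval p := by
  simp only [sub_neg_eq_add]

include hA₀ in
omit B in
/-- `|ν′ − ν| ≤ A₀`. -/
theorem abs_frameShiftedLevel_sub_le (p : Fin 2 → ℝ) : |(ν - (fun q : Fin 2 → ℝ => -K.eval q) p) - ν| ≤ A₀ := by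
  rw [sub_sub_cancel_left, abs_neg]; exact abs_negEval_le hA₀ p

include hA₀ in
omit B in
/-- `ν′ ∈ [ν − A₀, ν + A₀]`. -/
theorem frameShiftedLevel_mem_Icc_margin (p : Fin 2 → ℝ) : ν - (fun q : Fin 2 → ℝ => -K.eval q) p ∈ Icc (ν - A₀) (ν + A₀) := by
  have h := abs_le.1 (abs_frameShiftedLevel_sub_le hA₀ (ν := ν) p)
  exact ⟨by linarith [h.1], by linarith [h.2]⟩

include B hA₀ hlo hhi in
/-- **`ν′(θ) ∈ [a, b]`** at the frame's own Fermi point. -/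
theorem frameShiftedLevel_mem_Icc (θ : ℝ) :
    ν - (fun q : Fin 2 → ℝ => -K.eval q) (perturbedFermiRadius (fun p : Fin 2 → ℝ => -K.eval p) ν θ • dir θ) ∈ Icc a b :=
  shiftedLevel_perturbedFermiRadius_mem_Icc B (contDiff_four_negEval (K := K)).continuous (fun k _ => abs_negEval_le hA₀ k) hlo hhi θ

include B hA₀ hlo hhi in
/-- **ORDER 0 IS EXACT: `u_K(θ) = u_{ν′(θ)}(θ)`** — the frame's Fermi radius is the FREE Fermi radius at the shifted level
(the tree's `perturbedFermiRadius_eq_bandFermiRadius`, recorded in the lineage's hypotheses). -/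
theorem frameRadius_eq_bandFermiRadius_shiftedLevel (θ : ℝ) :
    perturbedFermiRadius (fun p : Fin 2 → ℝ => -K.eval p) ν θ =
      bandFermiRadius (ν - (fun q : Fin 2 → ℝ => -K.eval q) (perturbedFermiRadius (fun p : Fin 2 → ℝ => -K.eval p) ν θ • dir θ)) θ :=
  perturbedFermiRadius_eq_bandFermiRadius B (contDiff_four_negEval (K := K)).continuous (fun k _ => abs_negEval_le hA₀ k) hlo hhi θ

/-! ## §2 Frame versus free AT A COMMON POINT (any level `ν′ ∈ [a, b]` with `u_K(θ) = u_{ν′}(θ)`): orders 1–4, no `A₀` -/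

/-! ### §2.1 The free side at a level of the window -/

include B in
/-- The free radius at a level `ν′ ∈ [a, b]` is a root selection of `ε₀ + 0`. -/
theorem isBandFermiRadius_free_of_mem {ν' : ℝ} (hν' : ν' ∈ Icc a b) (ϑ : ℝ) :
    IsBandFermiRadius (ν' - (0 : (Fin 2 → ℝ) → ℝ) (bandFermiRadius ν' ϑ • dir ϑ)) ϑ (bandFermiRadius ν' ϑ) := by
  simpa using isBandFermiRadius_bandFermiRadius (B.ha.trans_le hν'.1) (hν'.2.trans_lt B.hb) ϑ

include B in
/-- The free radius at a level of the window is `C⁴`. -/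
theorem contDiff_four_bandFermiRadius_of_mem {ν' : ℝ} (hν' : ν' ∈ Icc a b) : ContDiff ℝ 4 (bandFermiRadius ν') :=
  contDiff_four_of_isRoot B (δ := (0 : (Fin 2 → ℝ) → ℝ)) contDiff_const (κ₀ := 0) (κ₁ := 0) (fun k _ => by simp)
    (by simpa using hν'.1) (by simpa using hν'.2) (fun k _ => by simp) B.Dtmin_pos (isBandFermiRadius_free_of_mem B hν')

include B in
/-- `0 ≤ u_{ν′}(ϑ) ≤ U₀` ⇒ `|u_{ν′}(ϑ)| ≤ U₀`. -/
theorem abs_bandFermiRadius_le_of_mem {ν' U₀ : ℝ} (hν' : ν' ∈ Icc a b) {ϑ : ℝ} (hU₀ : bandFermiRadius ν' ϑ ≤ U₀) :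
    |bandFermiRadius ν' ϑ| ≤ U₀ := by
  rw [abs_of_pos (bandFermiRadius_pos (B.ha.trans_le hν'.1) (hν'.2.trans_lt B.hb) ϑ)]; exact hU₀

/-! ### §2.2 The level-function differences at a common point: `Δ_j = ‖Dʲδ_K‖ ≤ 2ʲA_j` -/

include hA₁ in
omit B in
/-- `Δ₁`: `‖D(ε₀ + δ_K)(x) − Dε₀(x)‖ ≤ 2A₁`. -/
theorem norm_fderiv_frameBand_sub_free_le (x : Fin 2 → ℝ) :
    ‖fderiv ℝ (fun k : Fin 2 → ℝ => sqDispersion k + (fun p : Fin 2 → ℝ => -K.eval p) k) x -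
        fderiv ℝ (fun k : Fin 2 → ℝ => sqDispersion k + (0 : (Fin 2 → ℝ) → ℝ) k) x‖ ≤ 2 * A₁ := by
  rw [fderiv_pertBand_sub (δ := (0 : (Fin 2 → ℝ) → ℝ)) (δ' := fun p : Fin 2 → ℝ => -K.eval p) contDiff_const contDiff_four_negEval x,
    add_sub_cancel_left]
  simpa using norm_fderiv_negEval_le hA₁ x

include hA₂ in
omit B in
/-- `Δ₂`: `‖D²(ε₀ + δ_K)(x) − D²ε₀(x)‖ ≤ 4A₂`. -/
theorem norm_fderiv_two_frameBand_sub_free_le (x : Fin 2 → ℝ) :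
    ‖fderiv ℝ (fderiv ℝ (fun k : Fin 2 → ℝ => sqDispersion k + (fun p : Fin 2 → ℝ => -K.eval p) k)) x -
        fderiv ℝ (fderiv ℝ (fun k : Fin 2 → ℝ => sqDispersion k + (0 : (Fin 2 → ℝ) → ℝ) k)) x‖ ≤ 4 * A₂ := by
  rw [fderiv_two_pertBand_sub (δ := (0 : (Fin 2 → ℝ) → ℝ)) (δ' := fun p : Fin 2 → ℝ => -K.eval p) contDiff_const contDiff_four_negEval x,
    add_sub_cancel_left]
  simpa using norm_fderiv_two_negEval_le hA₂ x

include hA₃ in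
omit B in
/-- `Δ₃`: `‖D³(ε₀ + δ_K)(x) − D³ε₀(x)‖ ≤ 8A₃`. -/
theorem norm_fderiv_three_frameBand_sub_free_le (x : Fin 2 → ℝ) :
    ‖fderiv ℝ (fderiv ℝ (fderiv ℝ (fun k : Fin 2 → ℝ => sqDispersion k + (fun p : Fin 2 → ℝ => -K.eval p) k))) x -
        fderiv ℝ (fderiv ℝ (fderiv ℝ (fun k : Fin 2 → ℝ => sqDispersion k + (0 : (Fin 2 → ℝ) → ℝ) k))) x‖ ≤ 8 * A₃ := by
  rw [fderiv_three_pertBand_sub (δ := (0 : (Fin 2 → ℝ) → ℝ)) (δ' := fun p : Fin 2 → ℝ => -K.eval p) contDiff_const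
    contDiff_four_negEval x, add_sub_cancel_left]
  simpa using norm_fderiv_three_frameShift_le hA₃ x

include hA₄ in
omit B in
/-- `Δ₄`: `‖D⁴(ε₀ + δ_K)(x) − D⁴ε₀(x)‖ ≤ 16A₄`. -/
theorem norm_fderiv_four_frameBand_sub_free_le (x : Fin 2 → ℝ) :
    ‖fderiv ℝ (fderiv ℝ (fderiv ℝ (fderiv ℝ (fun k : Fin 2 → ℝ => sqDispersion k + (fun p : Fin 2 → ℝ => -K.eval p) k)))) x -
        fderiv ℝ (fderiv ℝ (fderiv ℝ (fderiv ℝ (fun k : Fin 2 → ℝ => sqDispersion k + (0 : (Fin 2 → ℝ) → ℝ) k)))) x‖ ≤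
      16 * A₄ := by
  rw [fderiv_four_pertBand_sub (δ := (0 : (Fin 2 → ℝ) → ℝ)) (δ' := fun p : Fin 2 → ℝ => -K.eval p) contDiff_const
    contDiff_four_negEval x, add_sub_cancel_left]
  simpa using norm_fderiv_four_frameShift_le hA₄ x

/-! ### §2.3 The four orders at a common point -/

include B hA₀ hA₁ hA₁Dt hlo hhi in
/-- The frame's radius is `C⁴`. -/
theorem contDiff_four_frameRadius : ContDiff ℝ 4 (perturbedFermiRadius (fun p : Fin 2 → ℝ => -K.eval p) ν) :=
  contDiff_four_of_isRoot B contDiff_four_negEval (fun k _ => abs_negEval_le hA₀ k) hlo hhi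
    (fun k _ => norm_fderiv_negEval_le hA₁ k) hA₁Dt (isBandFermiRadius_frameRadius_perOrder B hA₀ hlo hhi)

include B hA₀ hA₁ hA₁Dt hlo hhi in
/-- **ORDER 1 at a common point.**  For a level `ν′ ∈ [a, b]` with `u_K(θ) = u_{ν′}(θ)`, `u_{ν′}(θ) ≤ U₀` and `|u_{ν′}′(θ)| ≤ R₁`:
`|u_K′(θ) − u_{ν′}′(θ)| ≤ (U₀ + R₁)·2A₁/(Dt_min − 2A₁)` — LINEAR in `A₁`, no `A₀`. [cite: BenfattoGiulianiMastropietro2006, §2.4 Lemma 2.1 (2.40)] -/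
theorem abs_deriv_frameRadius_sub_shifted_le {θ ν' U₀ R₁ : ℝ} (hν' : ν' ∈ Icc a b)
    (hvu : perturbedFermiRadius (fun p : Fin 2 → ℝ => -K.eval p) ν θ = bandFermiRadius ν' θ)
    (hU₀ : bandFermiRadius ν' θ ≤ U₀) (hR₁ : |deriv (bandFermiRadius ν') θ| ≤ R₁) :
    |deriv (perturbedFermiRadius (fun p : Fin 2 → ℝ => -K.eval p) ν) θ - deriv (bandFermiRadius ν') θ| ≤
      (U₀ + R₁) * (2 * A₁) / (B.Dtmin - 2 * A₁) := by
  have hv := isBandFermiRadius_frameRadius_perOrder B hA₀ hlo hhi (K := K)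
  have hu := isBandFermiRadius_free_of_mem B hν'
  have hp : perturbedFermiRadius (fun p : Fin 2 → ℝ => -K.eval p) ν θ • dir θ = bandFermiRadius ν' θ • dir θ := by rw [hvu]
  have h := abs_deriv_sub_le_of_polar_levels (e := fun k : Fin 2 → ℝ => sqDispersion k + (0 : (Fin 2 → ℝ) → ℝ) k)
    (e' := fun k : Fin 2 → ℝ => sqDispersion k + (fun p : Fin 2 → ℝ => -K.eval p) k) (u := bandFermiRadius ν')
    (v := perturbedFermiRadius (fun p : Fin 2 → ℝ => -K.eval p) ν) (c := ν') (c' := ν)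
    (contDiff_pertBand contDiff_const) (contDiff_pertBand contDiff_four_negEval)
    (contDiff_four_bandFermiRadius_of_mem B hν') (contDiff_four_frameRadius B hA₀ hA₁ hA₁Dt hlo hhi)
    (pertBand_level (δ := (0 : (Fin 2 → ℝ) → ℝ)) (μ := ν') (u := bandFermiRadius ν') hu)
    (pertBand_level (δ := fun p : Fin 2 → ℝ => -K.eval p) (μ := ν) (u := perturbedFermiRadius (fun p : Fin 2 → ℝ => -K.eval p) ν) hv)
    (sub_pos.2 hA₁Dt) (W₀ := 0) (Δ₁ := 2 * A₁) (Dtmin_sub_le_fderiv_frameBand_dir B hA₀ hA₁ hlo hhi θ)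
    (norm_fderiv_pertBand_le contDiff_four_negEval (fun k _ => norm_fderiv_negEval_le hA₁ k) hv θ)
    (by rw [hp]; exact norm_fderiv_frameBand_sub_free_le hA₁ _) (abs_bandFermiRadius_le_of_mem B hν' hU₀) hR₁
    (by rw [hvu, sub_self, abs_zero]) (θ := θ)
  simpa only [mul_zero, zero_add] using h

include B hA₀ hA₁ hA₂ hA₁Dt hlo hhi in
/-- **ORDER 2 at a common point (incremental).**  With `R₁′ ≥ |u_{ν′}′(θ)|, |u_K′(θ)|`, `R₂ ≥ |u_{ν′}″(θ)|`, `W₁ ≥ |u_K′(θ) − u_{ν′}′(θ)|`,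
`K₁ = R₁′ + U₀`: `|u_K″(θ) − u_{ν′}″(θ)| ≤ (4A₂K₁² + 8K₁W₁ + 2A₁(2R₁′ + U₀) + 8W₁ + (R₂ + U₀)·2A₁)/(Dt_min − 2A₁)` — linear in
`(A₁, A₂, W₁)`, no `A₀`. [cite: BenfattoGiulianiMastropietro2006, §2.4 Lemma 2.1 (2.40)] -/
theorem abs_deriv_two_frameRadius_sub_shifted_le {θ ν' U₀ R₁' R₂ W₁ : ℝ} (hν' : ν' ∈ Icc a b)
    (hvu : perturbedFermiRadius (fun p : Fin 2 → ℝ => -K.eval p) ν θ = bandFermiRadius ν' θ)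
    (hU₀ : bandFermiRadius ν' θ ≤ U₀) (hR₁ : |deriv (bandFermiRadius ν') θ| ≤ R₁')
    (hR₁' : |deriv (perturbedFermiRadius (fun p : Fin 2 → ℝ => -K.eval p) ν) θ| ≤ R₁')
    (hR₂ : |deriv (deriv (bandFermiRadius ν')) θ| ≤ R₂)
    (hW₁ : |deriv (perturbedFermiRadius (fun p : Fin 2 → ℝ => -K.eval p) ν) θ - deriv (bandFermiRadius ν') θ| ≤ W₁) :
    |deriv (deriv (perturbedFermiRadius (fun p : Fin 2 → ℝ => -K.eval p) ν)) θ - deriv (deriv (bandFermiRadius ν')) θ| ≤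
      (4 * A₂ * (R₁' + U₀) ^ 2 + 8 * (R₁' + U₀) * W₁ + 2 * A₁ * (2 * R₁' + U₀) + 8 * W₁ + (R₂ + U₀) * (2 * A₁)) /
        (B.Dtmin - 2 * A₁) := by
  have hv := isBandFermiRadius_frameRadius_perOrder B hA₀ hlo hhi (K := K)
  have hu := isBandFermiRadius_free_of_mem B hν'
  have hp : perturbedFermiRadius (fun p : Fin 2 → ℝ => -K.eval p) ν θ • dir θ = bandFermiRadius ν' θ • dir θ := by rw [hvu]
  have hU := abs_bandFermiRadius_le_of_mem B hν' hU₀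
  have h := abs_deriv_two_sub_le_of_polar_levels (e := fun k : Fin 2 → ℝ => sqDispersion k + (0 : (Fin 2 → ℝ) → ℝ) k)
    (e' := fun k : Fin 2 → ℝ => sqDispersion k + (fun p : Fin 2 → ℝ => -K.eval p) k) (u := bandFermiRadius ν')
    (v := perturbedFermiRadius (fun p : Fin 2 → ℝ => -K.eval p) ν) (c := ν') (c' := ν)
    (contDiff_pertBand contDiff_const) (contDiff_pertBand contDiff_four_negEval)
    (contDiff_four_bandFermiRadius_of_mem B hν') (contDiff_four_frameRadius B hA₀ hA₁ hA₁Dt hlo hhi)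
    (pertBand_level (δ := (0 : (Fin 2 → ℝ) → ℝ)) (μ := ν') (u := bandFermiRadius ν') hu)
    (pertBand_level (δ := fun p : Fin 2 → ℝ => -K.eval p) (μ := ν) (u := perturbedFermiRadius (fun p : Fin 2 → ℝ => -K.eval p) ν) hv)
    (sub_pos.2 hA₁Dt) (W₀ := 0) (Δ₁ := 2 * A₁) (Δ₂ := 4 * A₂) (Dtmin_sub_le_fderiv_frameBand_dir B hA₀ hA₁ hlo hhi θ)
    (norm_fderiv_pertBand_le contDiff_const (κ₁ := 0) (fun k _ => by simp) hu θ)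
    (norm_fderiv_two_pertBand_le contDiff_const hu (κ₂ := 0) (fun k _ => by simp) θ)
    (by rw [hp]; exact norm_fderiv_frameBand_sub_free_le hA₁ _) (by rw [hp]; exact norm_fderiv_two_frameBand_sub_free_le hA₂ _)
    hU (by rw [hvu]; exact hU) hR₁ hR₁' hR₂ (by rw [hvu, sub_self, abs_zero]) hW₁ (θ := θ)
  exact h.trans (le_of_eq (by ring))

include B hA₀ hA₁ hA₂ hA₃ hA₁Dt hlo hhi in
/-- **ORDER 3 at a common point (incremental).**  With common bounds `R₁′, R₂′`, free `R₃`, lower widths `W₁, W₂`, `K₁ = R₁′ + U₀`,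
`K₂ = R₂′ + 2R₁′ + U₀`: `|u_K‴ − u_{ν′}‴| ≤ (8A₃K₁³ + 12W₁K₁² + 3(4A₂K₁K₂ + 4((W₂ + 2W₁)K₁ + K₂W₁)) + 2A₁(3R₂′ + 3R₁′ + U₀) +`
`4(3W₂ + 3W₁) + R₃·2A₁)/(Dt_min − 2A₁)` — linear in `(A₁, A₂, A₃, W₁, W₂)`, no `A₀`. [cite: BenfattoGiulianiMastropietro2006, §2.4 Lemma 2.1 (2.40)] -/
theorem abs_deriv_three_frameRadius_sub_shifted_le {θ ν' U₀ R₁' R₂' R₃ W₁ W₂ : ℝ} (hν' : ν' ∈ Icc a b)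
    (hvu : perturbedFermiRadius (fun p : Fin 2 → ℝ => -K.eval p) ν θ = bandFermiRadius ν' θ)
    (hU₀ : bandFermiRadius ν' θ ≤ U₀) (hR₁ : |deriv (bandFermiRadius ν') θ| ≤ R₁')
    (hR₁' : |deriv (perturbedFermiRadius (fun p : Fin 2 → ℝ => -K.eval p) ν) θ| ≤ R₁')
    (hR₂ : |deriv (deriv (bandFermiRadius ν')) θ| ≤ R₂')
    (hR₂' : |deriv (deriv (perturbedFermiRadius (fun p : Fin 2 → ℝ => -K.eval p) ν)) θ| ≤ R₂')
    (hR₃ : |deriv (deriv (deriv (bandFermiRadius ν'))) θ| ≤ R₃)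
    (hW₁ : |deriv (perturbedFermiRadius (fun p : Fin 2 → ℝ => -K.eval p) ν) θ - deriv (bandFermiRadius ν') θ| ≤ W₁)
    (hW₂ : |deriv (deriv (perturbedFermiRadius (fun p : Fin 2 → ℝ => -K.eval p) ν)) θ - deriv (deriv (bandFermiRadius ν')) θ| ≤ W₂) :
    |deriv (deriv (deriv (perturbedFermiRadius (fun p : Fin 2 → ℝ => -K.eval p) ν))) θ -
        deriv (deriv (deriv (bandFermiRadius ν'))) θ| ≤
      (8 * A₃ * (R₁' + U₀) ^ 3 + 12 * W₁ * (R₁' + U₀) ^ 2 +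
        3 * (4 * A₂ * (R₁' + U₀) * (R₂' + 2 * R₁' + U₀) + 4 * ((W₂ + 2 * W₁) * (R₁' + U₀) + (R₂' + 2 * R₁' + U₀) * W₁)) +
        2 * A₁ * (3 * R₂' + 3 * R₁' + U₀) + 4 * (3 * W₂ + 3 * W₁) + R₃ * (2 * A₁)) / (B.Dtmin - 2 * A₁) := by
  have hv := isBandFermiRadius_frameRadius_perOrder B hA₀ hlo hhi (K := K)
  have hu := isBandFermiRadius_free_of_mem B hν'
  have hp : perturbedFermiRadius (fun p : Fin 2 → ℝ => -K.eval p) ν θ • dir θ = bandFermiRadius ν' θ • dir θ := by rw [hvu]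
  have hU := abs_bandFermiRadius_le_of_mem B hν' hU₀
  have h := abs_deriv_three_sub_le_of_polar_levels (e := fun k : Fin 2 → ℝ => sqDispersion k + (0 : (Fin 2 → ℝ) → ℝ) k)
    (e' := fun k : Fin 2 → ℝ => sqDispersion k + (fun p : Fin 2 → ℝ => -K.eval p) k) (u := bandFermiRadius ν')
    (v := perturbedFermiRadius (fun p : Fin 2 → ℝ => -K.eval p) ν) (c := ν') (c' := ν)
    (contDiff_pertBand contDiff_const) (contDiff_pertBand contDiff_four_negEval)
    (contDiff_four_bandFermiRadius_of_mem B hν') (contDiff_four_frameRadius B hA₀ hA₁ hA₁Dt hlo hhi)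
    (pertBand_level (δ := (0 : (Fin 2 → ℝ) → ℝ)) (μ := ν') (u := bandFermiRadius ν') hu)
    (pertBand_level (δ := fun p : Fin 2 → ℝ => -K.eval p) (μ := ν) (u := perturbedFermiRadius (fun p : Fin 2 → ℝ => -K.eval p) ν) hv)
    (sub_pos.2 hA₁Dt) (W₀ := 0) (Δ₁ := 2 * A₁) (Δ₂ := 4 * A₂) (Δ₃ := 8 * A₃) (Dtmin_sub_le_fderiv_frameBand_dir B hA₀ hA₁ hlo hhi θ)
    (norm_fderiv_pertBand_le contDiff_const (κ₁ := 0) (fun k _ => by simp) hu θ)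
    (norm_fderiv_two_pertBand_le contDiff_const hu (κ₂ := 0) (fun k _ => by simp) θ)
    (norm_fderiv_three_pertBand_le contDiff_const hu (κ₃ := 0) (fun k _ => by simp) θ)
    (by rw [hp]; exact norm_fderiv_frameBand_sub_free_le hA₁ _) (by rw [hp]; exact norm_fderiv_two_frameBand_sub_free_le hA₂ _)
    (by rw [hp]; exact norm_fderiv_three_frameBand_sub_free_le hA₃ _)
    hU (by rw [hvu]; exact hU) hR₁ hR₁' hR₂ hR₂' hR₃ (by rw [hvu, sub_self, abs_zero]) hW₁ hW₂ (θ := θ)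
  exact h.trans (le_of_eq (by ring))

include B hA₀ hA₁ hA₂ hA₃ hA₄ hA₁Dt hlo hhi in
/-- **ORDER 4 at a common point (incremental).**  With common bounds `R₁′, R₂′, R₃′`, free `R₄`, lower widths `W₁, W₂, W₃`,
`K₁ = R₁′+U₀`, `K₂ = R₂′+2R₁′+U₀`, `K₃ = R₃′+3R₁′+3R₂′+U₀`, `δ₂ = W₂+2W₁`, `δ₃ = W₃+3W₁+3W₂`:
`|u_K⁗ − u_{ν′}⁗| ≤ (16A₄K₁⁴ + 16W₁K₁³ + 6(8A₃K₁²K₂ + 4(δ₂K₁² + 2K₁K₂W₁)) + 3(4A₂K₂² + 8K₂δ₂) + 4(4A₂K₁K₃ + 4(W₁K₃ + K₁δ₃)) +`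
`2A₁(6R₂′+4R₃′+4R₁′+U₀) + 4(6W₂+4W₃+4W₁) + R₄·2A₁)/(Dt_min − 2A₁)` — linear in `(A₁, …, A₄, W₁, W₂, W₃)`, no `A₀`.
[cite: BenfattoGiulianiMastropietro2006, §2.4 Lemma 2.1 (2.40)] -/
theorem abs_deriv_four_frameRadius_sub_shifted_le {θ ν' U₀ R₁' R₂' R₃' R₄ W₁ W₂ W₃ : ℝ} (hν' : ν' ∈ Icc a b)
    (hvu : perturbedFermiRadius (fun p : Fin 2 → ℝ => -K.eval p) ν θ = bandFermiRadius ν' θ)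
    (hU₀ : bandFermiRadius ν' θ ≤ U₀) (hR₁ : |deriv (bandFermiRadius ν') θ| ≤ R₁')
    (hR₁' : |deriv (perturbedFermiRadius (fun p : Fin 2 → ℝ => -K.eval p) ν) θ| ≤ R₁')
    (hR₂ : |deriv (deriv (bandFermiRadius ν')) θ| ≤ R₂')
    (hR₂' : |deriv (deriv (perturbedFermiRadius (fun p : Fin 2 → ℝ => -K.eval p) ν)) θ| ≤ R₂')
    (hR₃ : |deriv (deriv (deriv (bandFermiRadius ν'))) θ| ≤ R₃')
    (hR₃' : |deriv (deriv (deriv (perturbedFermiRadius (fun p : Fin 2 → ℝ => -K.eval p) ν))) θ| ≤ R₃')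
    (hR₄ : |deriv (deriv (deriv (deriv (bandFermiRadius ν')))) θ| ≤ R₄)
    (hW₁ : |deriv (perturbedFermiRadius (fun p : Fin 2 → ℝ => -K.eval p) ν) θ - deriv (bandFermiRadius ν') θ| ≤ W₁)
    (hW₂ : |deriv (deriv (perturbedFermiRadius (fun p : Fin 2 → ℝ => -K.eval p) ν)) θ - deriv (deriv (bandFermiRadius ν')) θ| ≤ W₂)
    (hW₃ : |deriv (deriv (deriv (perturbedFermiRadius (fun p : Fin 2 → ℝ => -K.eval p) ν))) θ -
      deriv (deriv (deriv (bandFermiRadius ν'))) θ| ≤ W₃) :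
    |deriv (deriv (deriv (deriv (perturbedFermiRadius (fun p : Fin 2 → ℝ => -K.eval p) ν)))) θ -
        deriv (deriv (deriv (deriv (bandFermiRadius ν')))) θ| ≤
      (16 * A₄ * (R₁' + U₀) ^ 4 + 16 * W₁ * (R₁' + U₀) ^ 3 +
        6 * (8 * A₃ * (R₁' + U₀) ^ 2 * (R₂' + 2 * R₁' + U₀) +
          4 * ((W₂ + 2 * W₁) * (R₁' + U₀) ^ 2 + 2 * (R₁' + U₀) * (R₂' + 2 * R₁' + U₀) * W₁)) +
        3 * (4 * A₂ * (R₂' + 2 * R₁' + U₀) ^ 2 + 8 * (R₂' + 2 * R₁' + U₀) * (W₂ + 2 * W₁)) +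
        4 * (4 * A₂ * (R₁' + U₀) * (R₃' + 3 * R₁' + 3 * R₂' + U₀) +
          4 * (W₁ * (R₃' + 3 * R₁' + 3 * R₂' + U₀) + (R₁' + U₀) * (W₃ + 3 * W₁ + 3 * W₂))) +
        2 * A₁ * (6 * R₂' + 4 * R₃' + 4 * R₁' + U₀) + 4 * (6 * W₂ + 4 * W₃ + 4 * W₁) + R₄ * (2 * A₁)) / (B.Dtmin - 2 * A₁) := by
  have hv := isBandFermiRadius_frameRadius_perOrder B hA₀ hlo hhi (K := K)
  have hu := isBandFermiRadius_free_of_mem B hν'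
  have hp : perturbedFermiRadius (fun p : Fin 2 → ℝ => -K.eval p) ν θ • dir θ = bandFermiRadius ν' θ • dir θ := by rw [hvu]
  have hU := abs_bandFermiRadius_le_of_mem B hν' hU₀
  have h := abs_deriv_four_sub_le_of_polar_levels (e := fun k : Fin 2 → ℝ => sqDispersion k + (0 : (Fin 2 → ℝ) → ℝ) k)
    (e' := fun k : Fin 2 → ℝ => sqDispersion k + (fun p : Fin 2 → ℝ => -K.eval p) k) (u := bandFermiRadius ν')
    (v := perturbedFermiRadius (fun p : Fin 2 → ℝ => -K.eval p) ν) (c := ν') (c' := ν)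
    (contDiff_pertBand contDiff_const) (contDiff_pertBand contDiff_four_negEval)
    (contDiff_four_bandFermiRadius_of_mem B hν') (contDiff_four_frameRadius B hA₀ hA₁ hA₁Dt hlo hhi)
    (pertBand_level (δ := (0 : (Fin 2 → ℝ) → ℝ)) (μ := ν') (u := bandFermiRadius ν') hu)
    (pertBand_level (δ := fun p : Fin 2 → ℝ => -K.eval p) (μ := ν) (u := perturbedFermiRadius (fun p : Fin 2 → ℝ => -K.eval p) ν) hv)
    (sub_pos.2 hA₁Dt) (W₀ := 0) (Δ₁ := 2 * A₁) (Δ₂ := 4 * A₂) (Δ₃ := 8 * A₃) (Δ₄ := 16 * A₄) (Dtmin_sub_le_fderiv_frameBand_dir B hA₀ hA₁ hlo hhi θ)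
    (norm_fderiv_pertBand_le contDiff_const (κ₁ := 0) (fun k _ => by simp) hu θ)
    (norm_fderiv_two_pertBand_le contDiff_const hu (κ₂ := 0) (fun k _ => by simp) θ)
    (norm_fderiv_three_pertBand_le contDiff_const hu (κ₃ := 0) (fun k _ => by simp) θ)
    (norm_fderiv_four_pertBand_le contDiff_const hu (κ₄ := 0) (fun k _ => by simp) θ)
    (by rw [hp]; exact norm_fderiv_frameBand_sub_free_le hA₁ _) (by rw [hp]; exact norm_fderiv_two_frameBand_sub_free_le hA₂ _)
    (by rw [hp]; exact norm_fderiv_three_frameBand_sub_free_le hA₃ _) (by rw [hp]; exact norm_fderiv_four_frameBand_sub_free_le hA₄ _)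
    hU (by rw [hvu]; exact hU) hR₁ hR₁' hR₂ hR₂' hR₃ hR₃' hR₄ (by rw [hvu, sub_self, abs_zero]) hW₁ hW₂ hW₃ (θ := θ)
  exact h.trans (le_of_eq (by ring))

end Frame

end Summit.HubbardSuperconductivity.HubbardSuperconductivity.Theorems.PerturbedFermiCurve

end
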